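import Mathlib.Analysis.InnerProductSpace.PiL2
import Literature.Analysis.FluidPDE.ParabolicComparison
import HarnessLib

/-!
# Two-point (doubling-of-variables) second-order test; weak maximum principle at local maxima

Topic `Literature/Analysis/FluidPDE` (family `ns`); analysis support for THEOREM U of
`pub/ns-exp-scalarLiouville/MAP.md` rev 2 §2 (files `TwoPointComparison`, `DriftDiffusionTypeIDrift*`).
`TwoPoint.weak_max_principle_localMax`: Lieberman's weak parabolic maximum principle (twin of the tree's
`weak_max_principle`) with the sub-solution implication stated at LOCAL MAXIMA, on any normed space.
`TwoPoint.twoPoint_secondOrder` (Kružkov doubling / Andrews–Clutterbuck two-point test): at an interior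
maximum `(x,y)`, `x ≠ y`, of `f(x) − f(y) − g(‖x−y‖) − κ(‖x‖²+‖y‖²) − c` (`f ∈ C²`):
`Df(x) = g′(r)⟨e,·⟩ + 2κ⟨x,·⟩`, `Df(y) = g′(r)⟨e,·⟩ − 2κ⟨y,·⟩`, `Δf(x) − Δf(y) ≤ 4g″(r) + 4nκ`
(lines `(x+σbᵢ, y+σbᵢ)` of an orthonormal basis with `b₀ = e = (x−y)/r`, and `(x+σe, y−σe)`).
WHAT THIS IS NOT: pure calculus; nothing about `stub_scalarLiouville`, crux 1222 or NS regularity.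
References: [Lieberman1996] Ch. II Lemma 2.1/2.3; [Kruzkov1970]; Andrews–Clutterbuck, J. AMS 24 (2011) §2.
-/

noncomputable section

open Set Function Filter Metric Topology InnerProductSpace
open scoped RealInnerProductSpace Laplacian Topology

namespace Literature.Analysis.FluidPDE

namespace TwoPoint

section WeakMax

variable {X : Type*} [NormedAddCommGroup X]

/-- **Weak parabolic maximum principle, local-maximum form** (Lieberman 1996, Ch. II, Lemma 2.1 with
Lemma 2.3; twin of the tree's `weak_max_principle` with the sub-solution implication `wₜ ≤ 0` required at
LOCAL MAXIMA of the slices, so that it applies on any normed space): `K` compact, `U ⊆ K` open, `w`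
continuous on `[T₁,T₂] × K` with a left time derivative on `(T₁,T₂] × U`, `w ≤ 0` on the parabolic
boundary ⇒ `w ≤ 0`. [cite: Lieberman1996, Ch. II Lemma 2.1 and Lemma 2.3] -/
theorem weak_max_principle_localMax {K U : Set X} (hK : IsCompact K) (hU : IsOpen U)
    (hUK : U ⊆ K) {T₁ T₂ : ℝ} {w wₜ : ℝ → X → ℝ}
    (hc : ContinuousOn (uncurry w) (Icc T₁ T₂ ×ˢ K))
    (ht : ∀ t ∈ Ioc T₁ T₂, ∀ x ∈ U, HasDerivWithinAt (fun s => w s x) (wₜ t x) (Icc T₁ t) t)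
    (hsub : ∀ t ∈ Ioc T₁ T₂, ∀ x ∈ U, IsLocalMax (w t) x → wₜ t x ≤ 0)
    (hbot : ∀ x ∈ K, w T₁ x ≤ 0)
    (hlat : ∀ t ∈ Icc T₁ T₂, ∀ x ∈ K \ U, w t x ≤ 0) :
    ∀ t ∈ Icc T₁ T₂, ∀ x ∈ K, w t x ≤ 0 := by
  by_contra H
  push Not at H
  obtain ⟨t₀, ht₀, x₀, hx₀, hpos⟩ := H
  set δ : ℝ := w t₀ x₀ with hδ
  set θ : ℝ := δ / (2 * (T₂ - T₁ + 1)) with hθ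
  have hT : T₁ ≤ T₂ := ht₀.1.trans ht₀.2
  have hθpos : 0 < θ := div_pos hpos (by linarith)
  have hθδ : θ * (t₀ - T₁) < δ := by
    have h1 : θ * (t₀ - T₁) ≤ θ * (T₂ - T₁ + 1) :=
      mul_le_mul_of_nonneg_left (by linarith [ht₀.2]) hθpos.le
    have h2 : θ * (T₂ - T₁ + 1) = δ / 2 := by
      rw [hθ, div_mul_eq_mul_div, mul_div_mul_right _ _ (by linarith : (T₂ - T₁ + 1) ≠ 0)]
    linarith
  set S : Set (ℝ × X) := Icc T₁ T₂ ×ˢ K with hS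
  have hSc : IsCompact S := isCompact_Icc.prod hK
  set g : ℝ × X → ℝ := fun p => w p.1 p.2 - θ * (p.1 - T₁) with hg
  have hgc : ContinuousOn g S := by
    have h3 : Continuous fun p : ℝ × X => θ * (p.1 - T₁) := by fun_prop
    exact hc.sub h3.continuousOn
  obtain ⟨⟨t', x'⟩, ⟨ht', hx'⟩, hmax⟩ := hSc.exists_isMaxOn ⟨(t₀, x₀), ht₀, hx₀⟩ hgc
  simp only at ht' hx'
  have hmax' : ∀ t ∈ Icc T₁ T₂, ∀ x ∈ K, w t x - θ * (t - T₁) ≤ w t' x' - θ * (t' - T₁) :=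
    fun t ht x hx => hmax (show (t, x) ∈ S from ⟨ht, hx⟩)
  have hgpos : 0 < w t' x' - θ * (t' - T₁) := by
    have := hmax' t₀ ht₀ x₀ hx₀
    linarith
  have hwpos : 0 < w t' x' := by
    have : 0 ≤ θ * (t' - T₁) := mul_nonneg hθpos.le (by linarith [ht'.1])
    linarith
  have ht'1 : T₁ < t' := by
    rcases eq_or_lt_of_le ht'.1 with h | h
    · exfalso
      have hb := hbot x' hx'
      rw [h] at hb
      linarith
    · exact h
  have hx'U : x' ∈ U := by
    by_contra hxU
    have hl := hlat t' ht' x' ⟨hx', hxU⟩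
    linarith
  have ht'I : t' ∈ Ioc T₁ T₂ := ⟨ht'1, ht'.2⟩
  have hloc : IsLocalMax (w t') x' := by
    filter_upwards [hU.mem_nhds hx'U] with x hx
    have := hmax' t' ht' x (hUK hx)
    linarith
  have hwt : wₜ t' x' ≤ 0 := hsub t' ht'I x' hx'U hloc
  have hderiv : HasDerivWithinAt (fun s => w s x' - θ * (s - T₁)) (wₜ t' x' - θ) (Icc T₁ t') t' := by
    have h1 := ht t' ht'I x' hx'U
    have h2 : HasDerivWithinAt (fun s : ℝ => θ * (s - T₁)) θ (Icc T₁ t') t' := by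
      have := ((hasDerivAt_id t').sub_const T₁).const_mul θ
      simpa using this.hasDerivWithinAt
    exact h1.sub h2
  have hmaxOn : IsLocalMaxOn (fun s => w s x' - θ * (s - T₁)) (Icc T₁ t') t' :=
    Filter.eventually_of_mem self_mem_nhdsWithin fun s hs =>
      hmax' s ⟨hs.1, hs.2.trans ht'.2⟩ x' hx'
  have hcone : T₁ - t' ∈ posTangentConeAt (Icc T₁ t') t' := by
    have hseg : segment ℝ t' T₁ ⊆ Icc T₁ t' := by
      rw [segment_symm, segment_eq_Icc ht'1.le]
    exact sub_mem_posTangentConeAt_of_segment_subset hseg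
  have key : (T₁ - t') * (wₜ t' x' - θ) ≤ 0 := by
    simpa using hmaxOn.hasFDerivWithinAt_nonpos hderiv.hasFDerivWithinAt hcone
  have hneg : T₁ - t' < 0 := by linarith
  have : 0 ≤ wₜ t' x' - θ := by
    by_contra hcon
    push Not at hcon
    have := mul_pos_of_neg_of_neg hneg hcon
    linarith
  linarith

end WeakMax

section Lines

variable {E : Type*} [NormedAddCommGroup E] [InnerProductSpace ℝ E]

/-- `⟪x + σ v, w⟫` is affine in `σ` with slope `⟪v, w⟫`. [folklore] -/
private theorem hasDerivAt_inner_line (x v w : E) (s : ℝ) :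
    HasDerivAt (fun σ : ℝ => ⟪x + σ • v, w⟫) ⟪v, w⟫ s := by
  have h : (fun σ : ℝ => ⟪x + σ • v, w⟫) = fun σ => ⟪x, w⟫ + σ * ⟪v, w⟫ := by
    funext σ; rw [inner_add_left, real_inner_smul_left]
  rw [h]
  simpa using ((hasDerivAt_id s).mul_const ⟪v, w⟫).const_add ⟪x, w⟫

/-- `d/dσ ‖x + σ v‖² = 2⟪x + σ v, v⟫`. [folklore] -/
private theorem hasDerivAt_normSq_line (x v : E) (s : ℝ) :
    HasDerivAt (fun σ : ℝ => ‖x + σ • v‖ ^ 2) (2 * ⟪x + s • v, v⟫) s := by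
  have hl : HasDerivAt (fun σ : ℝ => x + σ • v) v s := by
    simpa using ((hasDerivAt_id s).smul_const v).const_add x
  exact hl.norm_sq

/-- `d/dσ ‖z + σ u‖ = ⟪z, u⟫/‖z‖` at `σ = 0` for `z ≠ 0`. [folklore] -/
private theorem hasDerivAt_norm_line {z : E} (hz : z ≠ 0) (u : E) :
    HasDerivAt (fun σ : ℝ => ‖z + σ • u‖) (⟪z, u⟫ / ‖z‖) 0 := by
  have h1 := hasDerivAt_normSq_line z u 0
  rw [zero_smul, add_zero] at h1
  have hz' : ‖z + (0 : ℝ) • u‖ ^ 2 ≠ 0 := by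
    rw [zero_smul, add_zero]; positivity
  have h2 := h1.sqrt hz'
  have hfun : (fun σ : ℝ => Real.sqrt (‖z + σ • u‖ ^ 2)) = fun σ => ‖z + σ • u‖ := by
    funext σ; rw [Real.sqrt_sq (norm_nonneg _)]
  rw [hfun, zero_smul, add_zero, Real.sqrt_sq (norm_nonneg _)] at h2
  convert h2 using 1
  field_simp

/-- One-dimensional second-order test in the form used below: a local maximum at `0` of a function
differentiable near `0` with derivative `F'`, itself differentiable at `0`, forces `F''(0) ≤ 0`.
[folklore] -/
private theorem line_second_test {F F' : ℝ → ℝ} {F''0 : ℝ} (hmax : IsLocalMax F 0)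
    (hF : ∀ᶠ s in 𝓝 (0 : ℝ), HasDerivAt F (F' s) s) (hF' : HasDerivAt F' F''0 0) : F''0 ≤ 0 := by
  have hc : ContinuousAt F 0 := (hF.self_of_nhds).continuousAt
  have hd : deriv F =ᶠ[𝓝 0] F' := hF.mono fun s h => h.deriv
  have h2 : deriv (deriv F) 0 = F''0 := by
    rw [hd.deriv_eq]; exact hF'.deriv
  rw [← h2]
  exact IsLocalMax.deriv_deriv_nonpos hmax hc

/-- Second derivative along a line: `d/dσ|₀ (Df(x + σu) u) = D²f(x)[u,u]`. [folklore] -/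
private theorem hasDerivAt_fderiv_line {f : E → ℝ} (hf : ContDiff ℝ 2 f) (x u : E) :
    HasDerivAt (fun σ : ℝ => fderiv ℝ f (x + σ • u) u) (iteratedFDeriv ℝ 2 f x ![u, u]) 0 := by
  have hD1 : ContDiff ℝ 1 fun z => fderiv ℝ f z u :=
    (hf.fderiv_right (m := 1) le_rfl).clm_apply contDiff_const
  have h2 := hasDerivAt_comp_line (hD1.differentiable one_ne_zero) x u 0
  rw [zero_smul, add_zero] at h2
  have h3 : fderiv ℝ (fun z => fderiv ℝ f z u) x u = iteratedFDeriv ℝ 2 f x ![u, u] := by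
    rw [iteratedFDeriv_two_apply]
    have hd : DifferentiableAt ℝ (fderiv ℝ f) x :=
      ((hf.fderiv_right (m := 1) le_rfl).differentiable one_ne_zero) x
    rw [fderiv_clm_apply hd (differentiableAt_const u)]
    simp
  rw [← h3]
  exact h2

/-- `D²f(y)[−e,−e] = D²f(y)[e,e]`. [folklore] -/
private theorem iteratedFDeriv_two_neg (f : E → ℝ) (y e : E) :
    iteratedFDeriv ℝ 2 f y ![-e, -e] = iteratedFDeriv ℝ 2 f y ![e, e] := by
  rw [iteratedFDeriv_two_apply, iteratedFDeriv_two_apply]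
  simp

variable [FiniteDimensional ℝ E]

/-- **The two-point second-order test** (Kružkov doubling of variables; Andrews–Clutterbuck). At a local
maximum `(x, y)`, `x ≠ y`, of `W(x,y) = f(x) − f(y) − g(‖x−y‖) − κ(‖x‖² + ‖y‖²) − c` (`f ∈ C²`, `g`
differentiable near `r = ‖x−y‖`, `g′` differentiable at `r`): `Df(x) = g′(r)⟨e,·⟩ + 2κ⟨x,·⟩`,
`Df(y) = g′(r)⟨e,·⟩ − 2κ⟨y,·⟩`, and `Δf(x) − Δf(y) ≤ 4g″(r) + 4nκ`.
[cite: Kruzkov1970, §3 (doubling of variables)] [cite: Lieberman1996, Ch. II Lemma 2.1 (proof)] -/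
theorem twoPoint_secondOrder {f : E → ℝ} (hf : ContDiff ℝ 2 f) {g g' : ℝ → ℝ} {g'' κ c : ℝ}
    {x y : E} (hxy : x ≠ y)
    (hg : ∀ᶠ ρ in 𝓝 ‖x - y‖, HasDerivAt g (g' ρ) ρ) (hg2 : HasDerivAt g' g'' ‖x - y‖)
    (hmax : IsLocalMax (fun q : E × E =>
      f q.1 - f q.2 - g ‖q.1 - q.2‖ - κ * (‖q.1‖ ^ 2 + ‖q.2‖ ^ 2) - c) (x, y)) :
    (∀ u, fderiv ℝ f x u = g' ‖x - y‖ * (⟪x - y, u⟫ / ‖x - y‖) + 2 * κ * ⟪x, u⟫) ∧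
    (∀ u, fderiv ℝ f y u = g' ‖x - y‖ * (⟪x - y, u⟫ / ‖x - y‖) - 2 * κ * ⟪y, u⟫) ∧
    (Δ f) x - (Δ f) y ≤ 4 * g'' + 4 * (Module.finrank ℝ E) * κ := by
  set W : E × E → ℝ := fun q => f q.1 - f q.2 - g ‖q.1 - q.2‖ - κ * (‖q.1‖ ^ 2 + ‖q.2‖ ^ 2) - c
    with hW
  set r : ℝ := ‖x - y‖ with hr
  have hz : x - y ≠ 0 := sub_ne_zero.2 hxy
  have hr0 : 0 < r := norm_pos_iff.2 hz
  have hfd : Differentiable ℝ f := hf.differentiable two_ne_zero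
  have hg0 : HasDerivAt g (g' r) r := hg.self_of_nhds
  have hline : ∀ (P : ℝ → E × E), Continuous P → P 0 = (x, y) → IsLocalMax (fun σ => W (P σ)) 0 := by
    intro P hP hP0
    have h1 : IsLocalMax W (P 0) := by rw [hP0]; exact hmax
    exact h1.comp_continuous hP.continuousAt
  have hA : ∀ u, fderiv ℝ f x u = g' r * (⟪x - y, u⟫ / r) + 2 * κ * ⟪x, u⟫ := by
    intro u
    have hP := hline (fun σ => (x + σ • u, y)) (by fun_prop) (by simp)
    have hF : HasDerivAt (fun σ : ℝ => W (x + σ • u, y))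
        (fderiv ℝ f x u - g' r * (⟪x - y, u⟫ / r) - κ * (2 * ⟪x, u⟫)) 0 := by
      have h1 := hasDerivAt_comp_line hfd x u 0
      rw [zero_smul, add_zero] at h1
      have h2 : HasDerivAt (fun σ : ℝ => g ‖x + σ • u - y‖) (g' r * (⟪x - y, u⟫ / r)) 0 := by
        have hn := hasDerivAt_norm_line hz u
        have hfun : (fun σ : ℝ => ‖x + σ • u - y‖) = fun σ => ‖x - y + σ • u‖ := by
          funext σ; rw [add_sub_right_comm]
        have hn' : HasDerivAt (fun σ : ℝ => ‖x + σ • u - y‖) (⟪x - y, u⟫ / ‖x - y‖) 0 := by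
          rw [hfun]; exact hn
        have hg0' : HasDerivAt g (g' r) (‖x + (0 : ℝ) • u - y‖) := by
          rw [zero_smul, add_zero]; exact hg0
        exact hg0'.comp 0 hn'
      have h3 := hasDerivAt_normSq_line x u 0
      rw [zero_smul, add_zero] at h3
      have h4 : HasDerivAt (fun σ : ℝ => κ * (‖x + σ • u‖ ^ 2 + ‖y‖ ^ 2)) (κ * (2 * ⟪x, u⟫)) 0 := by
        simpa using (h3.add_const (‖y‖ ^ 2)).const_mul κ
      exact (((h1.sub_const (f y)).sub h2).sub h4).sub_const c
    have := hP.hasDerivAt_eq_zero hF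
    linarith
  have hB : ∀ u, fderiv ℝ f y u = g' r * (⟪x - y, u⟫ / r) - 2 * κ * ⟪y, u⟫ := by
    intro u
    have hP := hline (fun σ => (x, y + σ • u)) (by fun_prop) (by simp)
    have hF : HasDerivAt (fun σ : ℝ => W (x, y + σ • u))
        (0 - fderiv ℝ f y u - g' r * (⟪x - y, -u⟫ / r) - κ * (2 * ⟪y, u⟫)) 0 := by
      have h1 := hasDerivAt_comp_line hfd y u 0
      rw [zero_smul, add_zero] at h1
      have h2 : HasDerivAt (fun σ : ℝ => g ‖x - (y + σ • u)‖) (g' r * (⟪x - y, -u⟫ / r)) 0 := by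
        have hn := hasDerivAt_norm_line hz (-u)
        have hfun : (fun σ : ℝ => ‖x - (y + σ • u)‖) = fun σ => ‖x - y + σ • (-u)‖ := by
          funext σ; rw [smul_neg, ← sub_sub, sub_eq_add_neg]
        have hn' : HasDerivAt (fun σ : ℝ => ‖x - (y + σ • u)‖) (⟪x - y, -u⟫ / ‖x - y‖) 0 := by
          rw [hfun]; exact hn
        have hg0' : HasDerivAt g (g' r) (‖x - (y + (0 : ℝ) • u)‖) := by
          rw [zero_smul, add_zero]; exact hg0
        exact hg0'.comp 0 hn'
      have h3 := hasDerivAt_normSq_line y u 0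
      rw [zero_smul, add_zero] at h3
      have h4 : HasDerivAt (fun σ : ℝ => κ * (‖x‖ ^ 2 + ‖y + σ • u‖ ^ 2)) (κ * (2 * ⟪y, u⟫)) 0 := by
        simpa using (h3.const_add (‖x‖ ^ 2)).const_mul κ
      exact ((((hasDerivAt_const (0 : ℝ) (f x)).sub h1).sub h2).sub h4).sub_const c
    have := hP.hasDerivAt_eq_zero hF
    rw [inner_neg_right] at this
    linear_combination (-1 : ℝ) * this
  refine ⟨hA, hB, ?_⟩
  set e : E := r⁻¹ • (x - y) with he
  have he1 : ‖e‖ = 1 := by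
    rw [he, norm_smul, Real.norm_of_nonneg (inv_nonneg.2 hr0.le), hr, inv_mul_cancel₀ hr0.ne']
  have hxy_e : x - y = r • e := by
    rw [he, smul_smul, mul_inv_cancel₀ hr0.ne', one_smul]
  haveI : Nontrivial E := nontrivial_of_ne x y hxy
  set n : ℕ := Module.finrank ℝ E with hn
  have hnpos : 0 < n := Module.finrank_pos
  set i₀ : Fin n := ⟨0, hnpos⟩ with hi₀
  have hon : Orthonormal ℝ (({i₀} : Set (Fin n)).restrict fun _ : Fin n => e) := by
    rw [orthonormal_iff_ite]
    intro i j
    have hij : i = j := Subsingleton.elim i j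
    subst hij
    simp [he1]
  obtain ⟨bON, hbON⟩ := hon.exists_orthonormalBasis_extension_of_card_eq (by simp [hn])
  have hb0 : bON i₀ = e := hbON i₀ rfl
  have hterm : ∀ i : Fin n, iteratedFDeriv ℝ 2 f x ![bON i, bON i] - iteratedFDeriv ℝ 2 f y ![bON i, bON i]
      ≤ 4 * κ + if i = i₀ then 4 * g'' else 0 := by
    intro i
    by_cases hi : i = i₀
    · -- the stretch line `(x + σ e, y − σ e)`
      rw [if_pos hi, hi, hb0]
      have hP := hline (fun σ => (x + σ • e, y + σ • (-e))) (by fun_prop) (by simp)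
      set F : ℝ → ℝ := fun σ => f (x + σ • e) - f (y + σ • (-e)) - g (r + 2 * σ)
        - κ * (‖x + σ • e‖ ^ 2 + ‖y + σ • (-e)‖ ^ 2) - c with hFdef
      have hnorm : ∀ σ : ℝ, -(r / 2) < σ → ‖x + σ • e - (y + σ • (-e))‖ = r + 2 * σ := by
        intro σ hσ
        have h1 : x + σ • e - (y + σ • (-e)) = (r + 2 * σ) • e := by
          rw [smul_neg, show x + σ • e - (y + -(σ • e)) = (x - y) + (2 * σ) • e by
            rw [mul_smul, two_smul]; abel, hxy_e, ← add_smul]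
        rw [h1, norm_smul, he1, mul_one, Real.norm_of_nonneg (by linarith)]
      have hev : (fun σ => W (x + σ • e, y + σ • (-e))) =ᶠ[𝓝 0] F := by
        have hopen : IsOpen {σ : ℝ | -(r / 2) < σ} := isOpen_lt continuous_const continuous_id
        filter_upwards [hopen.mem_nhds (show (0 : ℝ) ∈ {σ : ℝ | -(r / 2) < σ} by
          simp only [mem_setOf_eq]; linarith)] with σ hσ
        simp only [hW, hFdef, hnorm σ hσ]
      have hmaxF : IsLocalMax F 0 := hev.isLocalMax_iff.1 hP
      set F' : ℝ → ℝ := fun σ => fderiv ℝ f (x + σ • e) e - fderiv ℝ f (y + σ • (-e)) (-e)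
        - 2 * g' (r + 2 * σ) - κ * (2 * ⟪x + σ • e, e⟫ + 2 * ⟪y + σ • (-e), -e⟫) with hF'def
      have hgnear : ∀ᶠ σ in 𝓝 (0 : ℝ), HasDerivAt g (g' (r + 2 * σ)) (r + 2 * σ) := by
        have hct : Tendsto (fun σ : ℝ => r + 2 * σ) (𝓝 0) (𝓝 r) := by
          have : Continuous (fun σ : ℝ => r + 2 * σ) := by fun_prop
          simpa using this.tendsto 0
        exact hct.eventually hg
      have hF : ∀ᶠ σ in 𝓝 (0 : ℝ), HasDerivAt F (F' σ) σ := by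
        filter_upwards [hgnear] with σ hσ
        have h1 := hasDerivAt_comp_line hfd x e σ
        have h2 := hasDerivAt_comp_line hfd y (-e) σ
        have h3 : HasDerivAt (fun s : ℝ => g (r + 2 * s)) (g' (r + 2 * σ) * 2) σ := by
          have hl : HasDerivAt (fun s : ℝ => r + 2 * s) 2 σ := by
            simpa using ((hasDerivAt_id σ).const_mul (2 : ℝ)).const_add r
          exact hσ.comp σ hl
        have h4 := hasDerivAt_normSq_line x e σ
        have h5 := hasDerivAt_normSq_line y (-e) σ
        have h6 : HasDerivAt (fun s : ℝ => κ * (‖x + s • e‖ ^ 2 + ‖y + s • (-e)‖ ^ 2))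
            (κ * (2 * ⟪x + σ • e, e⟫ + 2 * ⟪y + σ • (-e), -e⟫)) σ := (h4.add h5).const_mul κ
        have h7 : HasDerivAt (fun s : ℝ => f (x + s • e) - f (y + s • (-e)) - g (r + 2 * s)
            - κ * (‖x + s • e‖ ^ 2 + ‖y + s • (-e)‖ ^ 2) - c) (F' σ) σ :=
          ((((h1.sub h2).sub h3).sub h6).sub_const c).congr_deriv (by rw [hF'def]; ring)
        exact h7
      have hF' : HasDerivAt F' (iteratedFDeriv ℝ 2 f x ![e, e] - iteratedFDeriv ℝ 2 f y ![-e, -e]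
          - 4 * g'' - κ * (2 * ⟪e, e⟫ + 2 * ⟪-e, -e⟫)) 0 := by
        have h1 := hasDerivAt_fderiv_line hf x e
        have h2 := hasDerivAt_fderiv_line hf y (-e)
        have h3 : HasDerivAt (fun s : ℝ => 2 * g' (r + 2 * s)) (2 * (g'' * 2)) 0 := by
          have hl : HasDerivAt (fun s : ℝ => r + 2 * s) 2 0 := by
            simpa using ((hasDerivAt_id (0 : ℝ)).const_mul (2 : ℝ)).const_add r
          have hg2' : HasDerivAt g' g'' (r + 2 * 0) := by rw [mul_zero, add_zero]; exact hg2
          exact (hg2'.comp 0 hl).const_mul 2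
        have h4 := hasDerivAt_inner_line x e e 0
        have h5 := hasDerivAt_inner_line y (-e) (-e) 0
        have h6 : HasDerivAt (fun s : ℝ => κ * (2 * ⟪x + s • e, e⟫ + 2 * ⟪y + s • (-e), -e⟫))
            (κ * (2 * ⟪e, e⟫ + 2 * ⟪-e, -e⟫)) 0 := ((h4.const_mul 2).add (h5.const_mul 2)).const_mul κ
        exact (((h1.sub h2).sub h3).sub h6).congr_deriv (by ring)
      have key := line_second_test hmaxF hF hF'
      rw [iteratedFDeriv_two_neg] at key
      have hee : ⟪e, e⟫ = 1 := by rw [real_inner_self_eq_norm_sq, he1, one_pow]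
      have hee' : ⟪-e, -e⟫ = (1 : ℝ) := by rw [inner_neg_neg, hee]
      rw [hee, hee'] at key
      linarith
    · -- the parallel line `(x + σ v, y + σ v)`
      rw [if_neg hi, add_zero]
      set v : E := bON i with hv
      have hv1 : ‖v‖ = 1 := bON.orthonormal.1 i
      have hP := hline (fun σ => (x + σ • v, y + σ • v)) (by fun_prop) (by simp)
      set F' : ℝ → ℝ := fun σ => fderiv ℝ f (x + σ • v) v - fderiv ℝ f (y + σ • v) v
        - κ * (2 * ⟪x + σ • v, v⟫ + 2 * ⟪y + σ • v, v⟫) with hF'def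
      have hF : ∀ᶠ σ in 𝓝 (0 : ℝ), HasDerivAt (fun s => W (x + s • v, y + s • v)) (F' σ) σ := by
        refine Filter.Eventually.of_forall fun σ => ?_
        have h1 := hasDerivAt_comp_line hfd x v σ
        have h2 := hasDerivAt_comp_line hfd y v σ
        have h4 := hasDerivAt_normSq_line x v σ
        have h5 := hasDerivAt_normSq_line y v σ
        have h6 : HasDerivAt (fun s : ℝ => κ * (‖x + s • v‖ ^ 2 + ‖y + s • v‖ ^ 2))
            (κ * (2 * ⟪x + σ • v, v⟫ + 2 * ⟪y + σ • v, v⟫)) σ := (h4.add h5).const_mul κ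
        have hconst : ∀ s : ℝ, ‖x + s • v - (y + s • v)‖ = r := by
          intro s; rw [hr]; congr 1; abel
        have h7 : HasDerivAt (fun s : ℝ => f (x + s • v) - f (y + s • v) - g r
            - κ * (‖x + s • v‖ ^ 2 + ‖y + s • v‖ ^ 2) - c) (F' σ) σ :=
          ((((h1.sub h2).sub_const (g r)).sub h6).sub_const c).congr_deriv (by rw [hF'def])
        have hfun : (fun s : ℝ => W (x + s • v, y + s • v)) =
            fun s : ℝ => f (x + s • v) - f (y + s • v) - g r - κ * (‖x + s • v‖ ^ 2 + ‖y + s • v‖ ^ 2) - c := by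
          funext s; simp only [hW, hconst s]
        rw [hfun]
        exact h7
      have hF' : HasDerivAt F' (iteratedFDeriv ℝ 2 f x ![v, v] - iteratedFDeriv ℝ 2 f y ![v, v]
          - κ * (2 * ⟪v, v⟫ + 2 * ⟪v, v⟫)) 0 := by
        have h1 := hasDerivAt_fderiv_line hf x v
        have h2 := hasDerivAt_fderiv_line hf y v
        have h4 := hasDerivAt_inner_line x v v 0
        have h5 := hasDerivAt_inner_line y v v 0
        have h6 : HasDerivAt (fun s : ℝ => κ * (2 * ⟪x + s • v, v⟫ + 2 * ⟪y + s • v, v⟫))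
            (κ * (2 * ⟪v, v⟫ + 2 * ⟪v, v⟫)) 0 := ((h4.const_mul 2).add (h5.const_mul 2)).const_mul κ
        exact (h1.sub h2).sub h6
      have key := line_second_test hP hF hF'
      have hvv : ⟪v, v⟫ = 1 := by rw [real_inner_self_eq_norm_sq, hv1, one_pow]
      rw [hvv] at key
      linarith
  rw [laplacian_eq_iteratedFDeriv_orthonormalBasis f bON]
  simp only
  rw [← Finset.sum_sub_distrib]
  calc ∑ i, (iteratedFDeriv ℝ 2 f x ![bON i, bON i] - iteratedFDeriv ℝ 2 f y ![bON i, bON i])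
      ≤ ∑ i : Fin n, (4 * κ + if i = i₀ then 4 * g'' else 0) := Finset.sum_le_sum fun i _ => hterm i
    _ = 4 * g'' + 4 * (n : ℝ) * κ := by
        rw [Finset.sum_add_distrib, Finset.sum_const, Finset.card_univ, Fintype.card_fin,
          Finset.sum_ite_eq' Finset.univ i₀, if_pos (Finset.mem_univ _), nsmul_eq_mul]
        ring

end Lines

end TwoPoint

end Literature.Analysis.FluidPDE

end
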